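import Summits.Ventures.YMGap.RobustBall.SummableEnergyLipschitz
import HarnessLib

/-!
# Venture YMGap, track ROBUST-BALL (tier 2) — the SMOOTHING lemma for the SUMMABLE (infinite-range)
# member: one application of the tier-2 kernel `γ^{W}_Λ` turns a bounded measurable `Λ`-local observable
# into a QUASILOCAL observable with sitewise Lipschitz bounds read off the summable cross coefficient

HONEST FRAMING. WHAT THIS IS: a venture file (cell `pub-ymgap`, track Y2 ROBUST-BALL, seat ds-3),
strong-coupling LATTICE bookkeeping for the TIER-2 member `N β S_W + W` of rb-p1's weighted ball
(`perturbedYMS ρ β W`). Part 2 of the tier-2 twin of the seat's `PerturbedSmoothing.lean` (tier 1, finite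
range, where the kernel average is a CYLINDER function on the finite `W`-collar). For an infinite-range
member the kernel average `γ^W_Λ F` reads EVERY link, so the collar method fails; instead:
(1) `specAvg_perturbedYMS_quasilocal` — `γ^W_Λ F` is QUASILOCAL (Föllmer's continuity (2.4)): boundary
    conditions agreeing on a large finite link set give values within `ε` (equal Wilson parts, tails of the
    volume majorant `abs_tsum_volume_sub_le_tail`, tilt oscillation);
(2) `isLipBound_specAvg_perturbedYMS` — `γ^W_Λ F` is Lipschitz in every OUTSIDE link `y` with the bound
    `M · K · m(y)` whenever the energy has moduli `m(y) ≤ L` in the outside links (supplied by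
    `abs_perturbedEnergyS_sub_le_of_eq_off`), `K = (e^{2·2√N·L} − 1)/(2√N · L)` (tilt oscillation,
    Georgii Prop. 8.8, and convexity in the distance and in the modulus).
With the seat's `QuasilocalCovariance.abs_sub_le_tsum_of_isLipBound_of_quasilocal` the two give the GLOBAL
summable Lipschitz vector of `γ^W_Λ F`; the covariance decay is assembled in `SummableMassiveBridge`.
WHAT IT IS NOT: no door, no row, no number of the cell; nothing about the continuum or the Clay problem.

References: H.-O. Georgii, Gibbs Measures and Phase Transitions (2011), Prop. 8.8; H. Föllmer, LNM 1362
(1988) Ch. I (2.4), Remark (2.17); S. Friedli, Y. Velenik (2017) §6.10.1.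
-/

noncomputable section

open MeasureTheory ProbabilityTheory Function Finset Filter Topology
open scoped NNReal
open Literature.Probability.LatticeModels
open Literature.Probability.LatticeModels.DobrushinMetric
open Literature.MathematicalPhysics.QuantumLattice
open Literature.MathematicalPhysics.QuantumFieldTheory hiding ZdEdge
open Literature.MathematicalPhysics.QuantumFieldTheory.Balaban1983to89
open Literature.MathematicalPhysics.QuantumFieldTheory.Balaban1983to89.StrongCouplingTorusWindow
open Summit.Ventures.YMGap.ZdSmoothing

namespace Summit.Ventures.YMGap.RobustBall

variable {d N : ℕ}

/-! ### `SU(N)`: quasilocality and sitewise Lipschitz bounds of the tier-2 smoothing -/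

section SUN

variable {W : Potential (ZdEdge d) (Matrix.specialUnitaryGroup (Fin N) ℂ)} {B : Finset (ZdEdge d) → ℝ}

/-- **QUASILOCALITY of the tier-2 kernel average** (Föllmer 1988, Ch. I, (2.4): continuity in the boundary
condition at infinity): for `F` measurable, depending only on the links of `Λ`, `|F| ≤ M`, and every `ε > 0`
there is a FINITE link set `Λ'` (the links of the plaquettes touching `Λ` and the links of finitely many
interaction sets carrying all but a small tail of the volume majorant) such that boundary conditions
agreeing on `Λ'` have kernel averages `γ^W_Λ F` within `ε` (equal Wilson parts, `abs_tsum_volume_sub_le_tail`,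
tilt oscillation `abs_integral_tilted_sub_integral_tilted_le`, and `e^x − 1 ≤ 2x` on `[0, 1]`). -/
theorem specAvg_perturbedYMS_quasilocal (b : ℝ) (h : IsLinkSummable W B)
    (hWc : ∀ X, Continuous (W X)) (hWdep : ∀ X, DependsOn (W X) (↑X : Set (ZdEdge d)))
    (Λ : Finset (ZdEdge d)) {F : LGConfig d (Matrix.specialUnitaryGroup (Fin N) ℂ) → ℝ} (hFm : Measurable F)
    (hFdep : DependsOn F (↑Λ : Set (ZdEdge d))) {M : ℝ} (hM : ∀ U, |F U| ≤ M) (ε : ℝ) (hε : 0 < ε) :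
    ∃ Λ' : Finset (ZdEdge d), ∀ σ τ : LGConfig d (Matrix.specialUnitaryGroup (Fin N) ℂ),
      (∀ z ∈ Λ', σ z = τ z) →
        |specAvg (perturbedYMS (fundamentalRep (Fin N)) b W) Λ F σ -
            specAvg (perturbedYMS (fundamentalRep (Fin N)) b W) Λ F τ| ≤ ε := by
  classical
  haveI : SecondCountableTopology (Matrix (Fin N) (Fin N) ℂ) :=
    inferInstanceAs (SecondCountableTopology (Fin N → Fin N → ℂ))
  haveI : SecondCountableTopology (Matrix.specialUnitaryGroup (Fin N) ℂ) :=
    Topology.IsEmbedding.subtypeVal.secondCountableTopology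
  haveI : Nonempty (LGConfig d (Matrix.specialUnitaryGroup (Fin N) ℂ)) := ⟨fun _ => 1⟩
  have hρc := continuous_fundamentalRep (Fin N)
  have hM0 : 0 ≤ M := (abs_nonneg _).trans (hM fun _ => 1)
  -- the tail size
  have hδ : 0 < min (1 / 4 : ℝ) (ε / (8 * M + 8)) := lt_min (by norm_num) (div_pos hε (by positivity))
  have hvol0 : ∀ X, 0 ≤ ∑ e ∈ Λ, (if e ∈ X then B X else 0) := fun X =>
    Finset.sum_nonneg fun e _ => by
      split_ifs
      · exact h.nonneg X fun _ => 1
      · exact le_rfl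
  obtain ⟨S, hS⟩ := exists_finset_tail_lt (h.summable_volume Λ) hvol0 hδ
  refine ⟨(plaquettesTouching Λ).biUnion plaquetteEdges ∪ S.biUnion id, fun σ τ hστ => ?_⟩
  rw [specAvg_perturbedYMS_eq_tilted _ hρc b h hWc Λ hFm σ, specAvg_perturbedYMS_eq_tilted _ hρc b h hWc Λ hFm τ]
  -- the integrand does not see the boundary condition
  have hint : ∀ ζ : ↥Λ → Matrix.specialUnitaryGroup (Fin N) ℂ, F (glueWith Λ ζ τ) = F (glueWith Λ ζ σ) :=
    fun ζ => hFdep fun z hz => by rw [glueWith_apply_mem _ _ _ hz, glueWith_apply_mem _ _ _ hz]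
  simp_rw [hint]
  -- the glued configurations agree on `Λ' ∪ Λ`
  have hglue : ∀ (ζ : ↥Λ → Matrix.specialUnitaryGroup (Fin N) ℂ) (z : ZdEdge d),
      z ∈ (plaquettesTouching Λ).biUnion plaquetteEdges ∪ S.biUnion id → glueWith Λ ζ σ z = glueWith Λ ζ τ z := by
    intro ζ z hz
    by_cases hzΛ : z ∈ Λ
    · rw [glueWith_apply_mem _ _ _ hzΛ, glueWith_apply_mem _ _ _ hzΛ]
    · rw [glueWith_apply_not_mem _ _ _ hzΛ, glueWith_apply_not_mem _ _ _ hzΛ]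
      exact hστ z hz
  -- the energies differ by at most `2 · tail`, uniformly in `ζ`
  set tail : ℝ := ∑' X : Finset (ZdEdge d), (if X ∈ S then 0 else ∑ e ∈ Λ, (if e ∈ X then B X else 0)) with htail
  have htail0 : 0 ≤ tail := tsum_nonneg fun X => by
    split_ifs
    · exact le_rfl
    · exact hvol0 X
  have hEdiff : ∀ ζ : ↥Λ → Matrix.specialUnitaryGroup (Fin N) ℂ,
      |perturbedEnergyS (fundamentalRep (Fin N)) b W Λ (glueWith Λ ζ σ) -
          perturbedEnergyS (fundamentalRep (Fin N)) b W Λ (glueWith Λ ζ τ) - 0| ≤ 2 * tail := by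
    intro ζ
    rw [sub_zero]
    have hW : wilsonBoundaryAction (fundamentalRep (Fin N)) Λ (glueWith Λ ζ σ) =
        wilsonBoundaryAction (fundamentalRep (Fin N)) Λ (glueWith Λ ζ τ) :=
      isCylinder_wilsonBoundaryAction_holds (fundamentalRep (Fin N)) Λ fun z hz =>
        hglue ζ z (Finset.mem_union_left _ hz)
    have hser := abs_tsum_volume_sub_le_tail h hWdep Λ S
      (Λ' := (plaquettesTouching Λ).biUnion plaquetteEdges ∪ S.biUnion id)
      (fun X hX z hz => Finset.mem_union_right _ (Finset.mem_biUnion.2 ⟨X, hX, hz⟩))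
      (U := glueWith Λ ζ σ) (V := glueWith Λ ζ τ) (fun z hz => hglue ζ z hz)
    have e : perturbedEnergyS (fundamentalRep (Fin N)) b W Λ (glueWith Λ ζ σ) -
        perturbedEnergyS (fundamentalRep (Fin N)) b W Λ (glueWith Λ ζ τ) =
        -((∑' X : Finset (ZdEdge d), (if (X ∩ Λ).Nonempty then W X (glueWith Λ ζ σ) else 0)) -
          ∑' X : Finset (ZdEdge d), (if (X ∩ Λ).Nonempty then W X (glueWith Λ ζ τ) else 0)) := by
      unfold perturbedEnergyS; rw [hW]; ring
    rw [e, abs_neg]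
    exact hser
  -- measurability and bounds of the tilting energies
  have hEc := continuous_perturbedEnergyS (fundamentalRep (Fin N)) hρc b h hWc Λ
  obtain ⟨BE, hBE⟩ := exists_abs_perturbedEnergyS_le (fundamentalRep (Fin N)) hρc b h Λ
  have hmeas : ∀ η : LGConfig d (Matrix.specialUnitaryGroup (Fin N) ℂ), Measurable
      fun ζ : ↥Λ → Matrix.specialUnitaryGroup (Fin N) ℂ =>
        perturbedEnergyS (fundamentalRep (Fin N)) b W Λ (glueWith Λ ζ η) := fun η =>
    hEc.measurable.comp (measurable_glueWith Λ η)
  have hbdd : ∀ η : LGConfig d (Matrix.specialUnitaryGroup (Fin N) ℂ), ∃ B', ∀ ζ : ↥Λ → _,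
      |perturbedEnergyS (fundamentalRep (Fin N)) b W Λ (glueWith Λ ζ η)| ≤ B' := fun η => ⟨BE, fun ζ => hBE _⟩
  have hφm : Measurable fun ζ : ↥Λ → Matrix.specialUnitaryGroup (Fin N) ℂ => F (glueWith Λ ζ σ) :=
    hFm.comp (measurable_glueWith Λ σ)
  have hφL : ∀ a' b' : ↥Λ → Matrix.specialUnitaryGroup (Fin N) ℂ,
      |F (glueWith Λ a' σ) - F (glueWith Λ b' σ)| ≤ 2 * M := fun a' b' =>
    (abs_sub _ _).trans (by linarith [hM (glueWith Λ a' σ), hM (glueWith Λ b' σ)])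
  have key := abs_integral_tilted_sub_integral_tilted_le
    (Measure.pi fun _ : ↥Λ => haarProbability (Matrix.specialUnitaryGroup (Fin N) ℂ))
    (hmeas σ) (hmeas τ) (hbdd σ) (hbdd τ) (κ := 0) hEdiff hφm ⟨M, fun ζ => hM _⟩ hφL
  refine key.trans ?_
  -- `(e^{4 tail} - 1)/2 · 2M ≤ 8 M tail ≤ ε`
  have htail1 : tail ≤ 1 / 4 := (hS.le.trans (min_le_left _ _))
  have htail2 : tail ≤ ε / (8 * M + 8) := (hS.le.trans (min_le_right _ _))
  have hx : |2 * (2 * tail)| ≤ 1 := by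
    rw [abs_of_nonneg (by positivity)]; linarith
  have hexp : Real.exp (2 * (2 * tail)) - 1 ≤ 2 * (2 * (2 * tail)) := by
    have h1 := Real.abs_exp_sub_one_le hx
    rw [abs_of_nonneg (by positivity : (0 : ℝ) ≤ 2 * (2 * tail))] at h1
    exact (le_abs_self _).trans h1
  calc (Real.exp (2 * (2 * tail)) - 1) / 2 * (2 * M) = M * (Real.exp (2 * (2 * tail)) - 1) := by ring
    _ ≤ M * (2 * (2 * (2 * tail))) := mul_le_mul_of_nonneg_left hexp hM0
    _ = 8 * M * tail := by ring
    _ ≤ 8 * M * (ε / (8 * M + 8)) := mul_le_mul_of_nonneg_left htail2 (by positivity)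
    _ ≤ ε := by
        rw [show 8 * M * (ε / (8 * M + 8)) = ε * (8 * M / (8 * M + 8)) by ring]
        have h1 : 8 * M / (8 * M + 8) ≤ 1 := (div_le_one (by positivity)).2 (by linarith)
        nlinarith

/-- **The tier-2 kernel average is Lipschitz in every OUTSIDE link** (Georgii 2011, Prop. 8.8, tilt
oscillation; tier-2 twin of `isLipBound_specAvg_perturbedYM`): for `SU(N)` (`N ≥ 1`), tree coupling `b`,
a summable member with continuous terms, and moduli `0 ≤ m(y) ≤ L` (`0 < L`) such that the energy satisfies
`|φ_Λ(U) − φ_Λ(V)| ≤ m(y) ‖U_y − V_y‖_F` whenever `U = V` off `y ∉ Λ`, every `F` measurable inside `Λ` with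
`|F| ≤ M` has `|γ^W_Λ F(σ) − γ^W_Λ F(τ)| ≤ M · K · m(y) · ‖σ_y − τ_y‖_F` whenever `σ = τ` off `y`
(and `0` for `y ∈ Λ`), with `K = (e^{2 · 2√N · L} − 1)/(2√N · L)` (convexity in both variables). -/
theorem isLipBound_specAvg_perturbedYMS (hN : 1 ≤ N) (b : ℝ) (h : IsLinkSummable W B)
    (hWc : ∀ X, Continuous (W X)) (Λ : Finset (ZdEdge d)) {m : ZdEdge d → ℝ} {L : ℝ} (hL : 0 < L)
    (hm0 : ∀ y, 0 ≤ m y) (hmL : ∀ y, m y ≤ L)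
    (hE : ∀ y, y ∉ Λ → ∀ U V : LGConfig d (Matrix.specialUnitaryGroup (Fin N) ℂ),
      (∀ z, z ≠ y → U z = V z) →
        |perturbedEnergyS (fundamentalRep (Fin N)) b W Λ U - perturbedEnergyS (fundamentalRep (Fin N)) b W Λ V| ≤
          m y * suFrobDist (U y) (V y))
    {F : LGConfig d (Matrix.specialUnitaryGroup (Fin N) ℂ) → ℝ} (hFm : Measurable F)
    (hFdep : DependsOn F (↑Λ : Set (ZdEdge d))) {M : ℝ} (hM : ∀ U, |F U| ≤ M) :
    IsLipBound suFrobDist (specAvg (perturbedYMS (fundamentalRep (Fin N)) b W) Λ F)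
      fun y => if y ∈ Λ then 0 else
        M * ((Real.exp (2 * (2 * Real.sqrt N) * L) - 1) / ((2 * Real.sqrt N) * L)) * m y := by
  classical
  haveI : SecondCountableTopology (Matrix (Fin N) (Fin N) ℂ) :=
    inferInstanceAs (SecondCountableTopology (Fin N → Fin N → ℂ))
  haveI : SecondCountableTopology (Matrix.specialUnitaryGroup (Fin N) ℂ) :=
    Topology.IsEmbedding.subtypeVal.secondCountableTopology
  have hρc := continuous_fundamentalRep (Fin N)
  have hM0 : 0 ≤ M := (abs_nonneg _).trans (hM fun _ => 1)
  have hN0 : (0 : ℝ) < N := by exact_mod_cast hN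
  set D : ℝ := 2 * Real.sqrt N with hDdef
  have hD : 0 < D := by rw [hDdef]; positivity
  set K : ℝ := (Real.exp (2 * D * L) - 1) / (D * L) with hKdef
  have hK0 : 0 ≤ K := div_nonneg (sub_nonneg.2 (Real.one_le_exp (by positivity))) (by positivity)
  have hEc := continuous_perturbedEnergyS (fundamentalRep (Fin N)) hρc b h hWc Λ
  obtain ⟨BE, hBE⟩ := exists_abs_perturbedEnergyS_le (fundamentalRep (Fin N)) hρc b h Λ
  refine ⟨fun y => ?_, fun y σ τ hστ => ?_⟩
  · split_ifs
    · exact le_rfl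
    · exact mul_nonneg (mul_nonneg hM0 hK0) (hm0 y)
  by_cases hy : y ∈ Λ
  · -- inside link: the kernel does not see `σ_y`
    have hglue : ∀ ζ : ↥Λ → Matrix.specialUnitaryGroup (Fin N) ℂ, glueWith Λ ζ σ = glueWith Λ ζ τ :=
      fun ζ => funext fun z => by
        by_cases hzy : z = y
        · subst hzy; rw [glueWith_apply_mem _ _ _ hy, glueWith_apply_mem _ _ _ hy]
        · exact glueWith_congr_of_eq_off Λ hστ ζ hzy
    rw [specAvg_perturbedYMS_eq_tilted _ hρc b h hWc Λ hFm σ, specAvg_perturbedYMS_eq_tilted _ hρc b h hWc Λ hFm τ]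
    simp_rw [hglue]
    rw [sub_self, abs_zero, if_pos hy, zero_mul]
  · -- outside link: tilt oscillation
    rw [if_neg hy]
    rw [specAvg_perturbedYMS_eq_tilted _ hρc b h hWc Λ hFm σ, specAvg_perturbedYMS_eq_tilted _ hρc b h hWc Λ hFm τ]
    have hint : ∀ ζ : ↥Λ → Matrix.specialUnitaryGroup (Fin N) ℂ, F (glueWith Λ ζ τ) = F (glueWith Λ ζ σ) :=
      fun ζ => hFdep fun z hz => by rw [glueWith_apply_mem _ _ _ hz, glueWith_apply_mem _ _ _ hz]
    simp_rw [hint]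
    have hmeas : ∀ η : LGConfig d (Matrix.specialUnitaryGroup (Fin N) ℂ), Measurable
        fun ζ : ↥Λ → Matrix.specialUnitaryGroup (Fin N) ℂ =>
          perturbedEnergyS (fundamentalRep (Fin N)) b W Λ (glueWith Λ ζ η) := fun η =>
      hEc.measurable.comp (measurable_glueWith Λ η)
    have hbdd : ∀ η : LGConfig d (Matrix.specialUnitaryGroup (Fin N) ℂ), ∃ B', ∀ ζ : ↥Λ → _,
        |perturbedEnergyS (fundamentalRep (Fin N)) b W Λ (glueWith Λ ζ η)| ≤ B' := fun η =>
      ⟨BE, fun ζ => hBE _⟩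
    set ε : ℝ := m y * suFrobDist (σ y) (τ y) with hεdef
    have hε : ∀ ζ : ↥Λ → Matrix.specialUnitaryGroup (Fin N) ℂ,
        |perturbedEnergyS (fundamentalRep (Fin N)) b W Λ (glueWith Λ ζ σ) -
          perturbedEnergyS (fundamentalRep (Fin N)) b W Λ (glueWith Λ ζ τ) - 0| ≤ ε := fun ζ => by
      rw [sub_zero]
      have h' := hE y hy (glueWith Λ ζ σ) (glueWith Λ ζ τ) (fun z hz => glueWith_congr_of_eq_off Λ hστ ζ hz)
      rwa [glueWith_apply_not_mem _ _ _ hy, glueWith_apply_not_mem _ _ _ hy] at h'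
    have hφm : Measurable fun ζ : ↥Λ → Matrix.specialUnitaryGroup (Fin N) ℂ => F (glueWith Λ ζ σ) :=
      hFm.comp (measurable_glueWith Λ σ)
    have hφL : ∀ a' b' : ↥Λ → Matrix.specialUnitaryGroup (Fin N) ℂ,
        |F (glueWith Λ a' σ) - F (glueWith Λ b' σ)| ≤ 2 * M := fun a' b' =>
      (abs_sub _ _).trans (by linarith [hM (glueWith Λ a' σ), hM (glueWith Λ b' σ)])
    have key := abs_integral_tilted_sub_integral_tilted_le
      (Measure.pi fun _ : ↥Λ => haarProbability (Matrix.specialUnitaryGroup (Fin N) ℂ))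
      (hmeas σ) (hmeas τ) (hbdd σ) (hbdd τ) (κ := 0) hε hφm ⟨M, fun ζ => hM _⟩ hφL
    refine key.trans ?_
    -- convexity twice: in the distance (`≤ D`) and in the modulus (`≤ L`)
    have hr0 : 0 ≤ suFrobDist (σ y) (τ y) := suFrobDist_nonneg _ _
    have hrD : suFrobDist (σ y) (τ y) ≤ D := suFrobDist_le _ _
    have h1 := exp_mul_sub_one_le_div_mul (k := suFrobDist (σ y) (τ y)) (K := D) (t := 2 * m y)
      hr0 hrD hD (mul_nonneg zero_le_two (hm0 y))
    have h2 := exp_mul_sub_one_le_div_mul (k := m y) (K := L) (t := 2 * D) (hm0 y) (hmL y) hL (by positivity)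
    have e1 : 2 * ε = suFrobDist (σ y) (τ y) * (2 * m y) := by rw [hεdef]; ring
    rw [e1]
    have e2 : D * (2 * m y) = m y * (2 * D) := by ring
    have e3 : L * (2 * D) = 2 * D * L := by ring
    have hsub0 : 0 ≤ Real.exp (L * (2 * D)) - 1 := sub_nonneg.2 (Real.one_le_exp (by positivity))
    calc (Real.exp (suFrobDist (σ y) (τ y) * (2 * m y)) - 1) / 2 * (2 * M)
        = M * (Real.exp (suFrobDist (σ y) (τ y) * (2 * m y)) - 1) := by ring
      _ ≤ M * (suFrobDist (σ y) (τ y) / D * (Real.exp (D * (2 * m y)) - 1)) :=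
          mul_le_mul_of_nonneg_left h1 hM0
      _ = M * (suFrobDist (σ y) (τ y) / D) * (Real.exp (m y * (2 * D)) - 1) := by rw [e2]; ring
      _ ≤ M * (suFrobDist (σ y) (τ y) / D) * (m y / L * (Real.exp (L * (2 * D)) - 1)) :=
          mul_le_mul_of_nonneg_left h2 (mul_nonneg hM0 (div_nonneg hr0 hD.le))
      _ = M * ((Real.exp (2 * D * L) - 1) / (D * L)) * m y * suFrobDist (σ y) (τ y) := by
          rw [e3]
          field_simp
      _ = M * K * m y * suFrobDist (σ y) (τ y) := by rw [hKdef]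

end SUN

end Summit.Ventures.YMGap.RobustBall

end
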